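import Literature.AlgebraicGeometry.HodgeTheory.ConjugateComplexPoints
import Literature.AlgebraicGeometry.Motives.BaseChangeProofs
import Literature.AlgebraicGeometry.Motives.SubschemeCyclesFundamentalProofs
import HarnessLib

/-!
# Fibres of a complexified family over conjugate complex points

Topic `Literature/AlgebraicGeometry/HodgeTheory` (family `hodge`). Theorems only (no definition, no
named fact, no `sorry`). Setting: a field `k` with an embedding `σ : k →+* ℂ`, a morphism
`g₀ : 𝒲₀ ⟶ T₀` of `k`-schemes, its complexification `g = g₀ ⊗_σ ℂ : 𝒲 ⟶ T`
(`Motives.baseChangeHom σ`), a complex point `t ∈ T(ℂ)` and an automorphism `τ` of `ℂ` over `k`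
acting on `T(ℂ)` by `HodgeTheory.conjPoint` (Lang, *Introduction to Algebraic Geometry*, III §4:
the conjugate `t^τ` of a point).

* `conjPoint_left_comp_baseChangeHomFst` — as a `k`-morphism `Spec ℂ → T₀`, the conjugate point
  `τ · t` is `Spec τ ≫ t` (the action on coordinates).
* `exists_iso_fiberOver_left_conjPoint` — **the fibres `𝒲_{τ·t}` and `𝒲_t` are isomorphic as
  schemes, compatibly with the projections to `𝒲₀`**: both are the fibre product of `g₀` with
  `Spec ℂ → T₀`, along `t` and along `Spec τ ≫ t`, and `Spec τ` is an isomorphism (Lang III §4: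
  `V^τ` is obtained from `V` by applying `τ` to the coefficients; as abstract schemes
  `V^τ ≅ V`). The isomorphism is NOT `ℂ`-linear (Serre's conjugate varieties), which is why only
  scheme-theoretic data are transported below, never Betti classes.
* `forall_height_add_le_conjPoint` — consequently **the slices over `t` and over `τ · t` of the
  preimage of a (`k`-)closed subset `Z ⊆ 𝒲₀` have the same dimension bound**: if every point of
  the slice over `t` has `height + p ≤ n`, so does every point of the slice over `τ · t`
  (heights of points are preserved by isomorphisms of schemes).

This is the bookkeeping step "the codimension of the spread support at one complex point over
the generic point of the parameter space is its codimension at every such point" of the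
spreading argument for algebraicity loci (Voisin, *Hodge Theory II*, §3.3.1; Charles–Schnell 2014,
proof of Prop. 11.3.11, Lemma 11.3.14: complex points over the same point of `T₀` are conjugate).

## References

* [Lang1958IAG] S. Lang, Introduction to Algebraic Geometry (1958), Ch. III §4 (conjugates of a
  point and of a variety over `k`).
* [VoisinHodgeII2003] C. Voisin, Hodge Theory and Complex Algebraic Geometry II (2003), §3.3.1.
* [CharlesSchnell2014Notes] F. Charles, C. Schnell, Notes on absolute Hodge classes (2014),
  Prop. 11.3.11 (proof), Lemma 11.3.14.
* [Hartshorne1977] R. Hartshorne, Algebraic Geometry (1977), II.3 (fibres, base extension).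
-/

noncomputable section

open CategoryTheory CategoryTheory.Limits AlgebraicGeometry Order

namespace Literature.AlgebraicGeometry.HodgeTheory

open Literature.AlgebraicGeometry.Motives

section HodgeTheory

variable {k : Type} [Field k] (σ : k →+* ℂ) {𝒲₀ T₀ : SchemeOver k} (g₀ : 𝒲₀ ⟶ T₀)

/-- **The conjugate point on coordinates**: the `k`-morphism `Spec ℂ → T₀` underlying `τ · t` is
`Spec τ` followed by the one underlying `t` (Lang III §4: `t^τ = (τ xᵢ(t))`). [cite: Lang1958IAG, Ch. III §4] -/
theorem conjPoint_left_comp_baseChangeHomFst (τ : ringAutOver σ)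
    (t : ComplexPoints ((baseChangeHom σ).obj T₀)) :
    (conjPoint σ T₀ τ t).left ≫ baseChangeHomFst σ T₀ =
      Spec.map (CommRingCat.ofHom (letI := σ.toAlgebra; ((τ : ℂ ≃ₐ[k] ℂ) : ℂ →+* ℂ))) ≫
        t.left ≫ baseChangeHomFst σ T₀ := by
  letI := σ.toAlgebra
  have e1 := AlgPoints.baseChangeEquiv_apply_left_comp_fst σ T₀
    (τ • (AlgPoints.baseChangeEquiv σ T₀).symm t)
  rw [AlgPoints.smul_left, AlgPoints.baseChangeEquiv_symm_apply_left] at e1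
  exact e1

/-- **Fibres over conjugate complex points are isomorphic schemes, compatibly with the projection
to `𝒲₀`.** For `g₀ : 𝒲₀ ⟶ T₀` over `k`, `g = g₀ ⊗_σ ℂ`, `t ∈ T(ℂ)` and `τ ∈ Aut(ℂ/k)`, there is an
isomorphism of schemes `𝒲_{τ·t} ≅ 𝒲_t` under which the two composites `𝒲_{τ·t} → 𝒲 → 𝒲₀` and
`𝒲_t → 𝒲 → 𝒲₀` agree: both fibres are `𝒲₀ ×_{T₀} Spec ℂ`, along `t` and along `Spec τ ≫ t`
(`conjPoint_left_comp_baseChangeHomFst`), and `Spec τ` is invertible. [cite: Lang1958IAG, Ch. III §4]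
[cite: Hartshorne1977, II.3 (base extension)] -/
theorem exists_iso_fiberOver_left_conjPoint (τ : ringAutOver σ)
    (t : ComplexPoints ((baseChangeHom σ).obj T₀)) :
    ∃ φ : (fiberOver ((baseChangeHom σ).map g₀) (conjPoint σ T₀ τ t)).left ≅
        (fiberOver ((baseChangeHom σ).map g₀) t).left,
      φ.hom ≫ (fiberι ((baseChangeHom σ).map g₀) t).left ≫ baseChangeHomFst σ 𝒲₀ =
        (fiberι ((baseChangeHom σ).map g₀) (conjPoint σ T₀ τ t)).left ≫ baseChangeHomFst σ 𝒲₀ := by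
  letI := σ.toAlgebra
  -- notation
  set g : (baseChangeHom σ).obj 𝒲₀ ⟶ (baseChangeHom σ).obj T₀ := (baseChangeHom σ).map g₀ with hg
  set y : ComplexPoints ((baseChangeHom σ).obj T₀) := conjPoint σ T₀ τ t with hy
  set e : Spec (CommRingCat.of ℂ) ⟶ Spec (CommRingCat.of ℂ) :=
    Spec.map (CommRingCat.ofHom ((τ : ℂ ≃ₐ[k] ℂ) : ℂ →+* ℂ)) with he
  haveI : IsIso e := by
    rw [he]
    change IsIso (Scheme.Spec.map (CommRingCat.ofHom ((τ : ℂ ≃ₐ[k] ℂ) : ℂ →+* ℂ)).op)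
    haveI : IsIso (CommRingCat.ofHom ((τ : ℂ ≃ₐ[k] ℂ) : ℂ →+* ℂ)) :=
      (RingEquiv.toCommRingCatIso (τ : ℂ ≃ₐ[k] ℂ).toRingEquiv).isIso_hom
    infer_instance
  -- the cartesian square `𝒲 → 𝒲₀` over `T → T₀`
  have Hsq : IsPullback g.left (baseChangeHomFst σ 𝒲₀) (baseChangeHomFst σ T₀) g₀.left :=
    isPullback_baseChange_map_left ℂ g₀
  -- the two fibres as fibre products of `g₀` along `Spec ℂ → T₀`
  have Ht : IsPullback ((fiberι g t).left ≫ baseChangeHomFst σ 𝒲₀) (pullback.snd g.left t.left)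
      g₀.left (t.left ≫ baseChangeHomFst σ T₀) :=
    (IsPullback.of_hasPullback g.left t.left).paste_horiz Hsq.flip
  have Hy : IsPullback ((fiberι g y).left ≫ baseChangeHomFst σ 𝒲₀) (pullback.snd g.left y.left)
      g₀.left (y.left ≫ baseChangeHomFst σ T₀) :=
    (IsPullback.of_hasPullback g.left y.left).paste_horiz Hsq.flip
  have hye : y.left ≫ baseChangeHomFst σ T₀ = e ≫ t.left ≫ baseChangeHomFst σ T₀ :=
    conjPoint_left_comp_baseChangeHomFst σ τ t
  rw [hye] at Hy
  -- absorb the isomorphism `Spec τ` into the leg to `Spec ℂ`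
  have Hiso : IsPullback e (e ≫ t.left ≫ baseChangeHomFst σ T₀) (t.left ≫ baseChangeHomFst σ T₀)
      (𝟙 T₀.left) :=
    IsPullback.of_horiz_isIso ⟨by simp⟩
  have Hy' : IsPullback ((fiberι g y).left ≫ baseChangeHomFst σ 𝒲₀) (pullback.snd g.left y.left ≫ e)
      g₀.left (t.left ≫ baseChangeHomFst σ T₀) := by
    have h := (Hy.flip.paste_horiz Hiso).flip
    rw [Category.comp_id] at h
    exact h
  refine ⟨Hy'.isoIsPullback _ _ Ht, ?_⟩
  exact Hy'.isoIsPullback_hom_fst _ _ Ht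

/-- **The dimension bound on the slices of a closed subset of `𝒲₀` is the same over conjugate
complex points.** For `Z ⊆ 𝒲₀` and the slices of its preimage in `𝒲 = 𝒲₀ ⊗_σ ℂ` over `t` and
over `τ · t`: if every point of the slice over `t` has `height + p ≤ n`, so does every point of
the slice over `τ · t` (transport along `exists_iso_fiberOver_left_conjPoint`; an isomorphism of
schemes preserves the heights of points). [cite: Lang1958IAG, Ch. III §4]
[cite: CharlesSchnell2014Notes, Lemma 11.3.14] -/
theorem forall_height_add_le_conjPoint (τ : ringAutOver σ)
    (t : ComplexPoints ((baseChangeHom σ).obj T₀)) (Z : Set 𝒲₀.left) (p n : ℕ)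
    (ht : ∀ z : (fiberOver ((baseChangeHom σ).map g₀) t).left,
      (fiberι ((baseChangeHom σ).map g₀) t).left.base z ∈
          (baseChangeHomFst σ 𝒲₀).base ⁻¹' Z → height z + p ≤ (n : ℕ∞)) :
    ∀ z : (fiberOver ((baseChangeHom σ).map g₀) (conjPoint σ T₀ τ t)).left,
      (fiberι ((baseChangeHom σ).map g₀) (conjPoint σ T₀ τ t)).left.base z ∈
          (baseChangeHomFst σ 𝒲₀).base ⁻¹' Z → height z + p ≤ (n : ℕ∞) := by
  obtain ⟨φ, hφ⟩ := exists_iso_fiberOver_left_conjPoint σ g₀ τ t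
  intro z hz
  have hz' : (fiberι ((baseChangeHom σ).map g₀) t).left.base (φ.hom.base z) ∈
      (baseChangeHomFst σ 𝒲₀).base ⁻¹' Z := by
    have h := congrArg (fun ψ => ψ.base z) hφ
    simp only [Scheme.Hom.comp_base, TopCat.coe_comp, Function.comp_apply] at h
    simp only [Set.mem_preimage] at hz ⊢
    rw [h]
    exact hz
  rw [← height_base_eq_of_isClosedImmersion' φ.hom z]
  exact ht _ hz'

end HodgeTheory

end Literature.AlgebraicGeometry.HodgeTheory

end
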